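import Summits.HubbardSuperconductivity.HubbardSuperconductivity.Theorems.InfiniteVolumeFirstNoInfraredPileUpMassTransfer
import Summits.HubbardSuperconductivity.HubbardSuperconductivity.Theorems.InfiniteVolumeFirstTightnessExchangeVanishing
import Summits.HubbardSuperconductivity.HubbardSuperconductivity.Theorems.NoInfraredPileUp.Negative.KillIsCondensation
import Summits.HubbardSuperconductivity.HubbardSuperconductivity.Theorems.NoInfraredPileUp.Negative.NearGroundStates

/-!
# Crux `NoInfraredPileUp` (stmt-HubbardSuperconductivity-18534) — redirect strategist r1:
# THE SUMMIT-STRENGTH CERTIFICATE, packaged from landed theorems (no `sorry`)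

Seat planner-cstrat-stmt-HubbardSuperconductivity-18534-r1-0 (2026-08-17), second opinion on the
`no-strategy` census of seat b1. Companion of `STRATEGY-CENSUS.md` (r1 part). Everything below is
bookkeeping over LANDED tree theorems (`summitAt_iff_atomPos_and_noSliding` p151071,
`noSliding_iff_hasLongRangeOrder_of_atomPos` p150730, `stub_tightnessExchangeVanishing` /
`hubbardSuperconductivity_of_noSlidingCondensate` p150428, `limitODLRO_of_not_noInfraredPileUp`
p146252, `not_noInfraredPileUpNearGroundStates_of_weakCouplingLRO` p145689); it introduces four
ABBREVIATIONS (`Admissible`, `SummitAt`, `AtomsAt`, `NoSlidingAt`, `TightAt` — Prop-valued `def`s that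
unfold by `rfl` to the route's own matrices) so that the certificate can be read in one screen:

* `crux_iff`, `sister_iff`, `summit_iff` — the route's two cruxes and the summit ARE, by `Iff.rfl`,
  quantifier prefixes over the per-coupling matrices `TightAt`, `AtomsAt`, `SummitAt`.
* `summitAt_iff` — at every coupling `(U, δ)`:  `SummitAt U δ ↔ AtomsAt U δ ∧ NoSlidingAt U δ`
  (LANDED, p151071): the summit's conclusion is a LOSSLESS CONJUNCT SPLIT into the sister crux's
  matrix (atoms = infinite-volume ODLRO of every torus limit) and the load-bearing half `NoSlidingAt`
  of this crux's matrix (`noSlidingAt_of_tightAt`).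
* `noSlidingAt_iff_summitAt` — GIVEN the sister crux's atoms at `(U, δ)`, the load-bearing content of
  the crux at `(U, δ)` is EQUIVALENT to the summit's conclusion at `(U, δ)`.  This is the precise sense
  in which the crux is summit-strength: on the only branch where route InfiniteVolumeFirst is alive
  (atoms present), proving its rank-3 crux IS proving `d`-wave pair LRO of every admissible torus
  ground-state family — the Koma–Tasaki converse "infinite-volume ODLRO ⇒ finite-torus LRO" for the
  doped Hubbard model, for which no reflection-positivity-free engine exists (census r1 §T).
* `WeakCouplingExchange`, `weakCouplingExchange_of_crux`, `summit_of_weakCouplingExchange` — the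
  WEAKEST statement that can replace the crux in the route without touching `closes`' logic:
  "at every doping, for all weak couplings, atoms ⇒ LRO".  The crux implies it; with the sister crux it
  gives the summit; and at each coupling it is `AtomsAt → NoSlidingAt` (`weakCouplingExchangeAt_iff`).
* `summitAt_imp_noSlidingAt` — the load-bearing half is NECESSARY for the summit's conclusion at the
  same coupling (so replacing the crux by it loses nothing), while the filed crux `= Sub₁ ∧ Sub₂`
  exceeds what the summit gives back by exactly Sub₂ (anti-fragmentation with a macroscopic zero mode).
* `kill_is_condensation`, `wall` — the negation is an infinite-volume weak-coupling condensation theorem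
  (p146252) and any proof must use the exact eigen-equation at `O(1)` TOTAL energy (p145689), restated.

Nothing here is filed as an item; the census explains why no line / split is registered.
-/

noncomputable section

set_option linter.dupNamespace false

namespace Summit.HubbardSuperconductivity.HubbardSuperconductivity.Cruxes.NoInfraredPileUp.StrategistR1

open Literature.MathematicalPhysics.QuantumLattice Literature.Probability.LatticeModels Matrix Finset
  Filter
open Summit.HubbardSuperconductivity.HubbardSuperconductivity.Theses.InfiniteVolumeFirst
open Summit.HubbardSuperconductivity.HubbardSuperconductivity.Theorems
open Summit.HubbardSuperconductivity.HubbardSuperconductivity.Theorems.NoInfraredPileUp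
open Summit.HubbardSuperconductivity.HubbardSuperconductivity.Theorems.NoInfraredPileUp.Negative
open scoped ComplexOrder Topology

/-! ### Abbreviations (unfold by `rfl` to the route's matrices) -/

/-- Admissibility of a family at coupling `U`, doping `δ`: the common hypothesis of the summit and of
both cruxes (`N_L = 2⌊(1−δ)L²/2⌋`, `‖ψ_L‖ = 1`, `ψ_L` an `(N_L, S^z=0)`-sector ground state of
`hubbardTorus 2 L 1 U`, at every even `L`). [folklore] -/
def Admissible (U δ : ℝ) (N : ℕ → ℕ) (ψ : ∀ L, Fock (Orb (FermionTorus 2 L))) : Prop :=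
  ∀ L, Even L → N L = 2 * ⌊(1 - δ) * (L : ℝ) ^ 2 / 2⌋₊ ∧ star (ψ L) ⬝ᵥ ψ L = 1 ∧
    IsGroundStateInSector (hubbardTorus 2 L 1 U) (N L) 0 (ψ L)

/-- The summit's conclusion AT a coupling: every admissible family has `d`-wave pair-field LRO along
the even sides. (`HubbardSuperconductivity ↔ ∃ U > 0, ∃ δ ∈ (0,½), SummitAt U δ`, `summit_iff`.)
[folklore] -/
def SummitAt (U δ : ℝ) : Prop :=
  ∀ (N : ℕ → ℕ) (ψ : ∀ L, Fock (Orb (FermionTorus 2 L))), Admissible U δ N ψ →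
    HasLongRangeOrder (fun k => halfOpenBox 2 (2 * k))
      (fun k => torusPullback (pairFieldCorr dWaveFormFactor ψ) (2 * k))

/-- The sister crux's matrix AT a coupling: every pointwise torus-limit of the translation-averaged
`d`-wave pair correlations of every admissible family has a positive condensate atom (infinite-volume
ODLRO of every torus-limit ground state). [folklore] -/
def AtomsAt (U δ : ℝ) : Prop :=
  ∀ (N : ℕ → ℕ) (ψ : ∀ L, Fock (Orb (FermionTorus 2 L))), Admissible U δ N ψ →
    ∀ (Ls : ℕ → ℕ) (C : Site 2 → ℝ), StrictMono Ls → (∀ j, Even (Ls j)) →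
      (∀ x : Site 2, Tendsto (fun j : ℕ => (∑ y ∈ halfOpenBox 2 (Ls j),
          torusPullback (pairFieldCorr dWaveFormFactor ψ) (Ls j) (x + y) y) /
            ((Ls j : ℕ) : ℝ) ^ 2) atTop (𝓝 (C x))) →
        0 < liminf (fun R : ℕ => (∑ x ∈ halfOpenBox 2 R, ∑ y ∈ halfOpenBox 2 R,
          C (x - y)) / ((R : ℕ) : ℝ) ^ 4) atTop

/-- The load-bearing half (Sub₁, "no sliding condensate") of this crux's matrix AT a coupling: for every
admissible family, a small zero mode forces a tight small-momentum window, eventually. [folklore] -/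
def NoSlidingAt (U δ : ℝ) : Prop :=
  ∀ (N : ℕ → ℕ) (ψ : ∀ L, Fock (Orb (FermionTorus 2 L))), Admissible U δ N ψ →
    ∀ η : ℝ, 0 < η → ∃ θ : ℝ, 0 < θ ∧ ∃ ε : ℝ, 0 < ε ∧ ∃ L₀ : ℕ, ∀ (L : ℕ) [NeZero L],
      Even L → L₀ ≤ L →
        pairStructureFactor dWaveFormFactor L (ψ L) 0 ≤ θ * (L : ℝ) ^ 2 →
          (∑ m : Fin 2 → ZMod L, if m ≠ 0 ∧ momentumNormSq L m ≤ ε ^ 2 then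
              pairStructureFactor dWaveFormFactor L (ψ L) m else 0) ≤ η * (L : ℝ) ^ 2

/-- This crux's full matrix AT a coupling (tight windows for every admissible family, no zero-mode
premise): `NoInfraredPileUp ↔ ∀ δ ∈ (0,½) ∃ U₁>0 ∀ U ∈ (0,U₁), TightAt U δ` (`crux_iff`). [folklore] -/
def TightAt (U δ : ℝ) : Prop :=
  ∀ (N : ℕ → ℕ) (ψ : ∀ L, Fock (Orb (FermionTorus 2 L))), Admissible U δ N ψ →
    ∀ η : ℝ, 0 < η → ∃ ε : ℝ, 0 < ε ∧ ∃ L₀ : ℕ, ∀ (L : ℕ) [NeZero L], Even L → L₀ ≤ L →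
      (∑ m : Fin 2 → ZMod L, if m ≠ 0 ∧ momentumNormSq L m ≤ ε ^ 2 then
          pairStructureFactor dWaveFormFactor L (ψ L) m else 0) ≤ η * (L : ℝ) ^ 2

/-! ### The route's statements are quantifier prefixes over these matrices -/

/-- The crux, literally. [folklore] -/
theorem crux_iff :
    NoInfraredPileUp ↔ ∀ δ ∈ Set.Ioo (0:ℝ) (1 / 2), ∃ U₁ : ℝ, 0 < U₁ ∧ ∀ U ∈ Set.Ioo (0:ℝ) U₁,
      TightAt U δ :=
  Iff.rfl

/-- The sister crux (rank 2), literally. [folklore] -/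
theorem sister_iff :
    NoNormalLimitState ↔ ∃ δ ∈ Set.Ioo (0:ℝ) (1 / 2), ∀ U₀ : ℝ, 0 < U₀ → ∃ U ∈ Set.Ioo (0:ℝ) U₀,
      AtomsAt U δ :=
  Iff.rfl

/-- The summit, literally. [folklore] -/
theorem summit_iff :
    _root_.HubbardSuperconductivity ↔ ∃ U : ℝ, 0 < U ∧ ∃ δ ∈ Set.Ioo (0:ℝ) (1 / 2), SummitAt U δ :=
  Iff.rfl

/-! ### The certificate -/

/-- **Lossless conjunct split of the summit's conclusion, coupling by coupling** (LANDED as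
`summitAt_iff_atomPos_and_noSliding`, p151071; restated over the abbreviations). [folklore] -/
theorem summitAt_iff (U δ : ℝ) : SummitAt U δ ↔ AtomsAt U δ ∧ NoSlidingAt U δ :=
  summitAt_iff_atomPos_and_noSliding U δ

/-- The crux's matrix gives its load-bearing half (the zero-mode premise is simply not used).
[folklore] -/
theorem noSlidingAt_of_tightAt {U δ : ℝ} (h : TightAt U δ) : NoSlidingAt U δ := by
  intro N ψ hadm η hη
  obtain ⟨ε, hε, L₀, hL₀⟩ := h N ψ hadm η hη
  exact ⟨1, one_pos, ε, hε, L₀, fun L _ hL hLL _ => hL₀ L hL hLL⟩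

/-- **SUMMIT STRENGTH MODULO THE SISTER CRUX.** At a coupling where the sister crux's atoms hold —
the only branch on which route InfiniteVolumeFirst is alive — the load-bearing content of
`NoInfraredPileUp` is EQUIVALENT to the summit's conclusion at that coupling. [folklore] -/
theorem noSlidingAt_iff_summitAt {U δ : ℝ} (hA : AtomsAt U δ) : NoSlidingAt U δ ↔ SummitAt U δ := by
  rw [summitAt_iff]
  exact ⟨fun h => ⟨hA, h⟩, fun h => h.2⟩

/-- The load-bearing half is NECESSARY for the summit's conclusion at the same coupling (so a route
carrying it instead of the crux loses nothing). [folklore] -/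
theorem summitAt_imp_noSlidingAt {U δ : ℝ} (h : SummitAt U δ) : NoSlidingAt U δ :=
  ((summitAt_iff U δ).1 h).2

/-- The sister crux's matrix is necessary too. [folklore] -/
theorem summitAt_imp_atomsAt {U δ : ℝ} (h : SummitAt U δ) : AtomsAt U δ :=
  ((summitAt_iff U δ).1 h).1

/-- Hence, per coupling, the crux's matrix turns atoms into the summit's conclusion: the crux IS (at
least) the exchange-of-limits half of the summit, at every weak coupling. [folklore] -/
theorem summitAt_of_tightAt_of_atomsAt {U δ : ℝ} (hT : TightAt U δ) (hA : AtomsAt U δ) :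
    SummitAt U δ :=
  (noSlidingAt_iff_summitAt hA).1 (noSlidingAt_of_tightAt hT)

/-! ### The weakest replacement the route admits: the Koma–Tasaki converse at weak coupling -/

/-- `WeakCouplingExchange`: at every doping, for all sufficiently weak couplings, infinite-volume
ODLRO of every torus-limit ground state (atoms) implies `d`-wave pair LRO of every admissible torus
ground-state family. This is the EXACT residual of route InfiniteVolumeFirst once its rank-2 crux is
granted: implied by the filed crux (`weakCouplingExchange_of_crux`), sufficient with the sister crux
(`summit_of_weakCouplingExchange`), and per coupling literally `AtomsAt → NoSlidingAt`
(`weakCouplingExchangeAt_iff`). Koma–Tasaki, J. Stat. Phys. 76 (1994) 745 (LRO vs SSB in finite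
volume; the converse direction); Tasaki, J. Stat. Phys. 174 (2019) 735, §3.2. [folklore] -/
def WeakCouplingExchange : Prop :=
  ∀ δ ∈ Set.Ioo (0:ℝ) (1 / 2), ∃ U₁ : ℝ, 0 < U₁ ∧ ∀ U ∈ Set.Ioo (0:ℝ) U₁, AtomsAt U δ → SummitAt U δ

/-- Per coupling, "atoms ⇒ LRO" is the same as "atoms ⇒ no sliding". [folklore] -/
theorem weakCouplingExchangeAt_iff (U δ : ℝ) :
    (AtomsAt U δ → SummitAt U δ) ↔ (AtomsAt U δ → NoSlidingAt U δ) :=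
  ⟨fun h hA => summitAt_imp_noSlidingAt (h hA), fun h hA => (noSlidingAt_iff_summitAt hA).1 (h hA)⟩

/-- The filed crux implies the exchange. [folklore] -/
theorem weakCouplingExchange_of_crux (h : NoInfraredPileUp) : WeakCouplingExchange := by
  intro δ hδ
  obtain ⟨U₁, hU₁, h'⟩ := h δ hδ
  exact ⟨U₁, hU₁, fun U hU hA => summitAt_of_tightAt_of_atomsAt (h' U hU) hA⟩

/-- The exchange and the sister crux give the summit (same five lines of logic as the route's
`closes`; no harmonic analysis left — it is inside `summitAt_iff`). [folklore] -/
theorem summit_of_weakCouplingExchange (hX : WeakCouplingExchange) (h1 : NoNormalLimitState) :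
    _root_.HubbardSuperconductivity := by
  obtain ⟨δ, hδ, h1'⟩ := h1
  obtain ⟨U₁, hU₁, hX'⟩ := hX δ hδ
  obtain ⟨U, hU, hA⟩ := h1' U₁ hU₁
  exact ⟨U, hU.1, δ, hδ, hX' U hU hA⟩

/-- For comparison: the two filed cruxes give the summit (LANDED, p150428, restated). [folklore] -/
theorem summit_of_cruxes (h1 : NoNormalLimitState) (h2 : NoInfraredPileUp) :
    _root_.HubbardSuperconductivity :=
  summit_of_weakCouplingExchange (weakCouplingExchange_of_crux h2) h1

/-- **What the filed crux asks beyond the summit's own conclusion.** If the summit's conclusion held at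
EVERY weak coupling of every doping (`∀ δ ∃ U₁ ∀ U<U₁, SummitAt U δ` — far more than the summit), the
load-bearing half of the crux would follow (`summitAt_imp_noSlidingAt`) but NOT the crux itself: the
filed statement exceeds it by Sub₂ (a macroscopic zero mode leaves a tight window), which no amount of
long-range order gives back. Stated as the implication that IS available. [folklore] -/
theorem noSliding_everywhere_of_summit_everywhere
    (h : ∀ δ ∈ Set.Ioo (0:ℝ) (1 / 2), ∃ U₁ : ℝ, 0 < U₁ ∧ ∀ U ∈ Set.Ioo (0:ℝ) U₁, SummitAt U δ) :
    ∀ δ ∈ Set.Ioo (0:ℝ) (1 / 2), ∃ U₁ : ℝ, 0 < U₁ ∧ ∀ U ∈ Set.Ioo (0:ℝ) U₁, NoSlidingAt U δ := by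
  intro δ hδ
  obtain ⟨U₁, hU₁, h'⟩ := h δ hδ
  exact ⟨U₁, hU₁, fun U hU => summitAt_imp_noSlidingAt (h' U hU)⟩

/-! ### Negation and the wall (landed, restated for the record) -/

/-- **A kill is a condensation theorem** (LANDED, p146252): refuting the crux produces, at some doping
and in every coupling interval `(0, U₁)`, an admissible Hubbard ground-state family with
infinite-volume `d_{x²−y²}` ODLRO. [folklore] -/
theorem kill_is_condensation (h : ¬ NoInfraredPileUp) :
    ∃ δ ∈ Set.Ioo (0:ℝ) (1 / 2), ∀ U₁ : ℝ, 0 < U₁ → ∃ U ∈ Set.Ioo (0:ℝ) U₁,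
      ∃ (N : ℕ → ℕ) (ψ : ∀ L, Fock (Orb (FermionTorus 2 L))), Admissible U δ N ψ ∧
        ∃ (Ls : ℕ → ℕ) (C : Site 2 → ℝ), StrictMono Ls ∧ (∀ j, Even (Ls j)) ∧
          (∀ x : Site 2, Tendsto (fun j : ℕ => (∑ y ∈ halfOpenBox 2 (Ls j),
              torusPullback (pairFieldCorr dWaveFormFactor ψ) (Ls j) (x + y) y) /
                ((Ls j : ℕ) : ℝ) ^ 2) atTop (𝓝 (C x))) ∧
          0 < liminf (fun R : ℕ => (∑ x ∈ halfOpenBox 2 R, ∑ y ∈ halfOpenBox 2 R, C (x - y)) /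
            ((R : ℕ) : ℝ) ^ 4) atTop :=
  limitODLRO_of_not_noInfraredPileUp h

end Summit.HubbardSuperconductivity.HubbardSuperconductivity.Cruxes.NoInfraredPileUp.StrategistR1

end
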